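import Summits.CriticalPhenomena.PercolationContinuityZ3.Theorems.Transplant.FKConnectivityAllQAntipodalGadget
import HarnessLib

/-!
# Connectivity correlation inequalities for `φ_{w,q}`, every `q > 0` — file 49a: EARS — cluster counts and terminal connectivity after
# adding the edges of two 2-paths `p₁ – c₁ – q₁`, `p₂ – c₂ – q₂` through fresh vertices (tools for the theta hosts of file 49c)

Support file (`--supports stmt-CriticalPhenomena-4575`), FK sub-lane `prim-bschramm-fk-2` (gen 23); builds on p205010 (kernel theorem,
internal audit signed; external expert review pending).  No definitions, no named facts, no sorries; standard axioms.

An EAR of a host is a 2-path `p – c – q` whose middle vertex `c` meets no other edge.  For a configuration `R` avoiding `c`: a single ear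
edge is pendant (`k` drops by one, the connectivity of the old vertices is unchanged), the full ear drops `k` by `1 + 1{p ↮ q in R}`
(`FK.clusterCount_insert_path2`, gen 20) and joins `p` to `q`.  `FK.two_ears_counts` lists the fifteen counts for two ears presenting the
same pair `{a, b}`: `k(R ∪ X) = k(R) − |X| + cyc`, a cycle closing once per complete ear beyond the first `a–b` connection — the theta
law `cyc = (n − 1)⁺`.  Consumed by the bridge identity of file 49b (`FK.apPsiCW_maj3_theta_eq`).
[cite: Grimmett2006, §1.2 eq. (1.1) (p. 4); §1.4 eq. (1.20) (p. 15)]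
-/

noncomputable section

namespace Summit.CriticalPhenomena.PercolationContinuityZ3.Theorems

namespace FK

open SimpleGraph Literature.Probability.LatticeModels Literature.Probability.Percolation
open scoped Classical

variable {V : Type*}

section Ears
variable {R : Finset (Sym2 V)} {p q c a b : V}
/-- Reachability is invariant under re-presenting an unordered pair: `s(p,q) = s(a,b)` ⟹ (`p ↔ q` iff `a ↔ b`). [folklore] -/
theorem reachable_iff_of_sym2_eq (G : SimpleGraph V) (h : s(p, q) = s(a, b)) : G.Reachable p q ↔ G.Reachable a b := by
  rcases Sym2.eq_iff.1 h with ⟨rfl, rfl⟩ | ⟨rfl, rfl⟩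
  · exact Iff.rfl
  · exact ⟨Reachable.symm, Reachable.symm⟩
/-- Adding an edge at a fresh vertex `c` keeps every other vertex `c'` fresh. [folklore] -/
theorem fresh_insert {c' : V} (hc' : ∀ e ∈ R, c' ∉ e) (h1 : c' ≠ p) (h2 : c' ≠ c) :
    ∀ e ∈ insert s(p, c) R, c' ∉ e := by
  intro e he
  rcases Finset.mem_insert.1 he with rfl | he
  · rw [Sym2.mem_iff, not_or]; exact ⟨h1, h2⟩
  · exact hc' e he
/-- **Pendant ear edge, terminals**: inserting the edge `pc` at a fresh vertex `c` does not change whether two old vertices are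
joined. [folklore] -/
theorem reachable_insert_ear_left_iff (hc : ∀ e ∈ R, c ∉ e) {a' b' : V} (ha : a' ≠ c) (hb : b' ≠ c) :
    (openGraph (↑(insert s(p, c) R) : BondConfig V)).Reachable a' b' ↔ (openGraph (↑R : BondConfig V)).Reachable a' b' := by
  have hcR : ∀ e ∈ (↑R : BondConfig V), c ∉ e := fun e he => hc e (Finset.mem_coe.1 he)
  rw [Finset.coe_insert, KNSep.reachable_insert_iff]
  constructor
  · rintro (h | ⟨-, h⟩ | ⟨h, -⟩)
    · exact h
    · exact absurd h (not_reachable_of_isolated hcR hb)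
    · exact absurd h (not_reachable_of_isolated' hcR ha)
  · exact fun h => Or.inl h
/-- The same for the ear edge written `cq`. [folklore] -/
theorem reachable_insert_ear_right_iff (hc : ∀ e ∈ R, c ∉ e) {a' b' : V} (ha : a' ≠ c) (hb : b' ≠ c) :
    (openGraph (↑(insert s(c, q) R) : BondConfig V)).Reachable a' b' ↔ (openGraph (↑R : BondConfig V)).Reachable a' b' := by
  rw [Sym2.eq_swap]; exact reachable_insert_ear_left_iff hc ha hb
/-- **Full ear, terminals**: the 2-path `p – c – q` joins `p` to `q`. [folklore] -/
theorem reachable_insert_path2 (hpc : p ≠ c) (hqc : q ≠ c) :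
    (openGraph (↑(insert s(p, c) (insert s(c, q) R)) : BondConfig V)).Reachable p q :=
  (reachable_of_mem_edge hpc (Finset.mem_insert_self _ _)).trans
    (reachable_of_mem_edge hqc.symm (Finset.mem_insert_of_mem (Finset.mem_insert_self _ _)))
variable [Fintype V]
/-- **Pendant ear edge, count**: `k(R ∪ {pc}) + 1 = k(R)` for `c` fresh. [cite: Grimmett2006, §1.2 eq. (1.1) (p. 4)] -/
theorem clusterCount_insert_ear_left (hc : ∀ e ∈ R, c ∉ e) (hpc : p ≠ c) :
    clusterCount (↑(insert s(p, c) R) : BondConfig V) ∅ + 1 = clusterCount (↑R : BondConfig V) ∅ := by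
  rw [Sym2.eq_swap]; exact clusterCount_insert_pendant hc hpc.symm
/-- **Pendant ear edge, count**: `k(R ∪ {cq}) + 1 = k(R)` for `c` fresh. [cite: Grimmett2006, §1.2 eq. (1.1) (p. 4)] -/
theorem clusterCount_insert_ear_right (hc : ∀ e ∈ R, c ∉ e) (hqc : q ≠ c) :
    clusterCount (↑(insert s(c, q) R) : BondConfig V) ∅ + 1 = clusterCount (↑R : BondConfig V) ∅ :=
  clusterCount_insert_pendant hc hqc.symm
/-- **Full ear, count**: `k(R ∪ {pc, cq}) + 1 + 1{p ↮ q in R} = k(R)` for `c` fresh (`FK.clusterCount_insert_path2`).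
[cite: Grimmett2006, §1.2 eq. (1.1) (p. 4)] -/
theorem clusterCount_insert_ear_full (hc : ∀ e ∈ R, c ∉ e) (hpc : p ≠ c) (hqc : q ≠ c) :
    clusterCount (↑(insert s(p, c) (insert s(c, q) R)) : BondConfig V) ∅ + 1 +
        (if (openGraph (↑R : BondConfig V)).Reachable p q then 0 else 1) = clusterCount (↑R : BondConfig V) ∅ :=
  clusterCount_insert_path2 hc hpc hqc
end Ears

section TwoEars

variable [Fintype V]

omit [Fintype V] in
/-- ends of a pair presented as `s(a,b)` avoid a vertex avoided by `a` and `b`. [folklore] -/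
theorem ne_of_sym2_eq_of_ne {p q a b c : V} (h : s(p, q) = s(a, b)) (ha : a ≠ c) (hb : b ≠ c) : p ≠ c ∧ q ≠ c := by
  rcases Sym2.eq_iff.1 h with ⟨rfl, rfl⟩ | ⟨rfl, rfl⟩
  · exact ⟨ha, hb⟩
  · exact ⟨hb, ha⟩


/-- **Two ears, all counts.**  For a configuration `R` avoiding the fresh middle vertices `c₁ ≠ c₂` of the ears `p₁ – c₁ – q₁` and
`p₂ – c₂ – q₂` (both presenting the pair `{a, b}`), the cluster count after adding any set `X` of ear edges is `k(R) − |X| + cyc`, where a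
cycle closes once per complete ear beyond the first `a–b` connection (`ι = 1{a ↮ b in R}`). The fifteen nonempty cases.
[cite: Grimmett2006, §1.2 eq. (1.1) (p. 4)] -/
theorem two_ears_counts {R : Finset (Sym2 V)} {a b c₁ c₂ p₁ q₁ p₂ q₂ : V}
    (hpq₁ : s(p₁, q₁) = s(a, b)) (hpq₂ : s(p₂, q₂) = s(a, b))
    (hac₁ : a ≠ c₁) (hbc₁ : b ≠ c₁) (hac₂ : a ≠ c₂) (hbc₂ : b ≠ c₂) (hc₁₂ : c₁ ≠ c₂)
    (hR₁ : ∀ e ∈ R, c₁ ∉ e) (hR₂ : ∀ e ∈ R, c₂ ∉ e) :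
    clusterCount (↑(insert s(p₁, c₁) R) : BondConfig V) ∅ + (1) = clusterCount (↑(R) : BondConfig V) ∅ ∧
    clusterCount (↑(insert s(c₁, q₁) R) : BondConfig V) ∅ + (1) = clusterCount (↑(R) : BondConfig V) ∅ ∧
    clusterCount (↑(insert s(p₂, c₂) R) : BondConfig V) ∅ + (1) = clusterCount (↑(R) : BondConfig V) ∅ ∧
    clusterCount (↑(insert s(c₂, q₂) R) : BondConfig V) ∅ + (1) = clusterCount (↑(R) : BondConfig V) ∅ ∧
    clusterCount (↑(insert s(p₁, c₁) (insert s(c₁, q₁) R)) : BondConfig V) ∅ + (1 + (if (openGraph (↑R : BondConfig V)).Reachable a b then 0 else 1)) = clusterCount (↑(R) : BondConfig V) ∅ ∧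
    clusterCount (↑(insert s(p₁, c₁) (insert s(p₂, c₂) R)) : BondConfig V) ∅ + (2) = clusterCount (↑(R) : BondConfig V) ∅ ∧
    clusterCount (↑(insert s(p₁, c₁) (insert s(c₂, q₂) R)) : BondConfig V) ∅ + (2) = clusterCount (↑(R) : BondConfig V) ∅ ∧
    clusterCount (↑(insert s(c₁, q₁) (insert s(p₂, c₂) R)) : BondConfig V) ∅ + (2) = clusterCount (↑(R) : BondConfig V) ∅ ∧
    clusterCount (↑(insert s(c₁, q₁) (insert s(c₂, q₂) R)) : BondConfig V) ∅ + (2) = clusterCount (↑(R) : BondConfig V) ∅ ∧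
    clusterCount (↑(insert s(p₂, c₂) (insert s(c₂, q₂) R)) : BondConfig V) ∅ + (1 + (if (openGraph (↑R : BondConfig V)).Reachable a b then 0 else 1)) = clusterCount (↑(R) : BondConfig V) ∅ ∧
    clusterCount (↑(insert s(p₁, c₁) (insert s(c₁, q₁) (insert s(p₂, c₂) R))) : BondConfig V) ∅ + (2 + (if (openGraph (↑R : BondConfig V)).Reachable a b then 0 else 1)) =
      clusterCount (↑(R) : BondConfig V) ∅ ∧
    clusterCount (↑(insert s(p₁, c₁) (insert s(c₁, q₁) (insert s(c₂, q₂) R))) : BondConfig V) ∅ + (2 + (if (openGraph (↑R : BondConfig V)).Reachable a b then 0 else 1)) =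
      clusterCount (↑(R) : BondConfig V) ∅ ∧
    clusterCount (↑(insert s(p₁, c₁) (insert s(p₂, c₂) (insert s(c₂, q₂) R))) : BondConfig V) ∅ + (2 + (if (openGraph (↑R : BondConfig V)).Reachable a b then 0 else 1)) =
      clusterCount (↑(R) : BondConfig V) ∅ ∧
    clusterCount (↑(insert s(c₁, q₁) (insert s(p₂, c₂) (insert s(c₂, q₂) R))) : BondConfig V) ∅ + (2 + (if (openGraph (↑R : BondConfig V)).Reachable a b then 0 else 1)) =
      clusterCount (↑(R) : BondConfig V) ∅ ∧
    clusterCount (↑(insert s(p₁, c₁) (insert s(c₁, q₁) (insert s(p₂, c₂) (insert s(c₂, q₂) R)))) : BondConfig V) ∅ + (2 + (if (openGraph (↑R : BondConfig V)).Reachable a b then 0 else 1)) =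
      clusterCount (↑(R) : BondConfig V) ∅ := by
  obtain ⟨hp₁c₁, hq₁c₁⟩ := ne_of_sym2_eq_of_ne hpq₁ hac₁ hbc₁
  obtain ⟨hp₁c₂, hq₁c₂⟩ := ne_of_sym2_eq_of_ne hpq₁ hac₂ hbc₂
  obtain ⟨hp₂c₁, hq₂c₁⟩ := ne_of_sym2_eq_of_ne hpq₂ hac₁ hbc₁
  obtain ⟨hp₂c₂, hq₂c₂⟩ := ne_of_sym2_eq_of_ne hpq₂ hac₂ hbc₂
  -- ear 2 on R
  have Zg : ∀ e ∈ insert s(c₂, q₂) R, c₁ ∉ e := by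
    rw [Sym2.eq_swap]; exact fresh_insert hR₁ hq₂c₁.symm hc₁₂
  have Zy : ∀ e ∈ insert s(p₂, c₂) R, c₁ ∉ e := fresh_insert hR₁ hp₂c₁.symm hc₁₂
  have Zyg : ∀ e ∈ insert s(p₂, c₂) (insert s(c₂, q₂) R), c₁ ∉ e := by
    refine fresh_insert ?_ hp₂c₁.symm hc₁₂
    rw [Sym2.eq_swap]; exact fresh_insert hR₁ hq₂c₁.symm hc₁₂
  have kg := clusterCount_insert_ear_right hR₂ hq₂c₂ (q := q₂)
  have ky := clusterCount_insert_ear_left hR₂ hp₂c₂ (p := p₂)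
  have kyg := clusterCount_insert_ear_full hR₂ hp₂c₂ hq₂c₂
  -- reachability of the ends of ear 1 in the four ear-2 states
  have rg : (openGraph (↑(insert s(c₂, q₂) R) : BondConfig V)).Reachable p₁ q₁ ↔ (openGraph (↑R : BondConfig V)).Reachable a b :=
    (reachable_insert_ear_right_iff hR₂ hp₁c₂ hq₁c₂).trans (reachable_iff_of_sym2_eq _ hpq₁)
  have ry : (openGraph (↑(insert s(p₂, c₂) R) : BondConfig V)).Reachable p₁ q₁ ↔ (openGraph (↑R : BondConfig V)).Reachable a b :=
    (reachable_insert_ear_left_iff hR₂ hp₁c₂ hq₁c₂).trans (reachable_iff_of_sym2_eq _ hpq₁)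
  have ryg : (openGraph (↑(insert s(p₂, c₂) (insert s(c₂, q₂) R)) : BondConfig V)).Reachable p₁ q₁ := by
    rw [reachable_iff_of_sym2_eq _ hpq₁, ← reachable_iff_of_sym2_eq _ hpq₂]
    exact reachable_insert_path2 hp₂c₂ hq₂c₂
  have r0 : (openGraph (↑R : BondConfig V)).Reachable p₁ q₁ ↔ (openGraph (↑R : BondConfig V)).Reachable a b :=
    reachable_iff_of_sym2_eq _ hpq₁
  have r0' : (openGraph (↑R : BondConfig V)).Reachable p₂ q₂ ↔ (openGraph (↑R : BondConfig V)).Reachable a b :=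
    reachable_iff_of_sym2_eq _ hpq₂
  -- ear 1 on each of the four states
  have kx := clusterCount_insert_ear_left hR₁ hp₁c₁ (p := p₁)
  have kf := clusterCount_insert_ear_right hR₁ hq₁c₁ (q := q₁)
  have kxf := clusterCount_insert_ear_full hR₁ hp₁c₁ hq₁c₁
  have kxg := clusterCount_insert_ear_left Zg hp₁c₁ (p := p₁)
  have kfg := clusterCount_insert_ear_right Zg hq₁c₁ (q := q₁)
  have kxfg := clusterCount_insert_ear_full Zg hp₁c₁ hq₁c₁
  have kxy := clusterCount_insert_ear_left Zy hp₁c₁ (p := p₁)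
  have kfy := clusterCount_insert_ear_right Zy hq₁c₁ (q := q₁)
  have kxfy := clusterCount_insert_ear_full Zy hp₁c₁ hq₁c₁
  have kxyg := clusterCount_insert_ear_left Zyg hp₁c₁ (p := p₁)
  have kfyg := clusterCount_insert_ear_right Zyg hq₁c₁ (q := q₁)
  have kxfyg := clusterCount_insert_ear_full Zyg hp₁c₁ hq₁c₁
  rw [if_pos ryg] at kxfyg
  by_cases hr : (openGraph (↑R : BondConfig V)).Reachable a b
  · rw [if_pos (r0'.2 hr)] at kyg
    rw [if_pos (r0.2 hr)] at kxf
    rw [if_pos (rg.2 hr)] at kxfg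
    rw [if_pos (ry.2 hr)] at kxfy
    simp only [hr, if_true]
    refine ⟨?_, ?_, ?_, ?_, ?_, ?_, ?_, ?_, ?_, ?_, ?_, ?_, ?_, ?_, ?_⟩
    · clear * - kx; omega
    · clear * - kf; omega
    · clear * - ky; omega
    · clear * - kg; omega
    · clear * - kxf; omega
    · clear * - kxy ky; omega
    · clear * - kxg kg; omega
    · clear * - kfy ky; omega
    · clear * - kfg kg; omega
    · clear * - kyg; omega
    · clear * - kxfy ky; omega
    · clear * - kxfg kg; omega
    · clear * - kxyg kyg; omega
    · clear * - kfyg kyg; omega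
    · clear * - kxfyg kyg; omega
  · rw [if_neg (fun h => hr (r0'.1 h))] at kyg
    rw [if_neg (fun h => hr (r0.1 h))] at kxf
    rw [if_neg (fun h => hr (rg.1 h))] at kxfg
    rw [if_neg (fun h => hr (ry.1 h))] at kxfy
    simp only [hr, if_false]
    refine ⟨?_, ?_, ?_, ?_, ?_, ?_, ?_, ?_, ?_, ?_, ?_, ?_, ?_, ?_, ?_⟩
    · clear * - kx; omega
    · clear * - kf; omega
    · clear * - ky; omega
    · clear * - kg; omega
    · clear * - kxf; omega
    · clear * - kxy ky; omega
    · clear * - kxg kg; omega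
    · clear * - kfy ky; omega
    · clear * - kfg kg; omega
    · clear * - kyg; omega
    · clear * - kxfy ky; omega
    · clear * - kxfg kg; omega
    · clear * - kxyg kyg; omega
    · clear * - kfyg kyg; omega
    · clear * - kxfyg kyg; omega

end TwoEars

end FK

end Summit.CriticalPhenomena.PercolationContinuityZ3.Theorems

end
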